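import Literature.Analysis.FluidPDE.Wei2016HalfPlane
import Literature.Analysis.FluidPDE.AxisymShellLadyzhenskaya
import Literature.Analysis.FluidPDE.PlanarNashInequalityWholeSpace
import HarnessLib

/-!
# Nash's inequality on the meridian half-plane `Ω = {(r, z) : r > 0}` for axisymmetric scalars
# (Gallay–Šverák 2015, the display after (5.8) in the proof of Prop. 5.3)

Analysis/FluidPDE proof file (theorems only; no definitions, no named facts).

Gallay–Šverák (*Remarks on the Cauchy problem for the axisymmetric Navier–Stokes equations*,
Confluentes Math. 7 (2015) 67–92 = arXiv:1510.01036) estimate the `L^p(Ω)` norms of the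
axisymmetric vorticity `ω_θ` on the half-plane `Ω = {(r, z) : r > 0}` equipped with the
TWO-dimensional measure `dr dz` (their (1.5)), and the input of the `L²` step of their Prop. 5.3
(arXiv p. 16) is

> "The celebrated Nash inequality [Na] asserts that
> `∫_Ω ω_θ² dr dz ≤ C (∫_Ω |ω_θ| dr dz) (∫_Ω |∇ω_θ|² dr dz)^{1/2}`."

(J. Nash, Amer. J. Math. 80 (1958), p. 936, `n = 2`; valid on the half-plane for functions vanishing
on the axis `r = 0`, by even/odd reflection across the axis.) The tree works on `ℝ³` with
axisymmetric scalars `h` (functions of `(r, z) = (cylRadius x, x₂)`) and `dx = r dr dθ dz`, so that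
`∫_Ω F dr dz = (2π)⁻¹ ∫_{ℝ³} F/r dx`. This file proves the half-plane Nash inequality in that
vocabulary:

* (private) `integrable_and_integral_eq_two_mul_of_even` — a function on `ℝ × ℝ` even in the
  first variable and integrable on the half-plane `(0, ∞) × ℝ` is integrable on the plane with
  `∫ F = 2 ∫_{(0,∞)×ℝ} F` (reflection `(ρ, z) ↦ (−ρ, z)` preserves Lebesgue measure);
  `integrable_profile_and_integral_eq_of_cylRadius_mul_eq` — for axisymmetric `X`, `Y` with
  `r X = Y`, `X` continuous integrable: `∫_{ℝ×ℝ} Y(ρ,0,z) = (2/c₂) ∫ X dx`.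
* `sq_integral_sq_le_nash_prod` — the planar Nash inequality of the tree
  (`sq_integral_sq_le_nash_of_integrable`, on `EuclideanSpace ℝ (Fin 2)`) transported to `ℝ × ℝ`:
  `(∫ g²)² ≤ 4 C_GNS (∫ |g|)² ∫ ‖Dg‖²` for `g ∈ C¹(ℝ × ℝ)` with `g ∈ L¹ ∩ L²`, `Dg ∈ L²`
  (same constant: the coordinate map `EuclideanSpace ℝ (Fin 2) → ℝ × ℝ` preserves the measure and
  has operator norm `≤ 1`).
* `sq_integral_le_nash_halfPlane` — **Nash on `Ω` in `ℝ³` vocabulary.** Let `h : ℝ³ → ℝ` be a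
  `C¹` axisymmetric scalar and let `X₁, X₂, X_D` be continuous integrable axisymmetric scalars with
  `r X₁ = |h|`, `r X₂ = h²`, `r X_D = ‖Dh‖²` pointwise (so `h` vanishes on the axis and
  `∫ X₂ dx = 2π ∫_Ω h² dr dz`, `∫ X₁ dx = 2π ∫_Ω |h| dr dz`, `∫ X_D dx = 2π ∫_Ω |∇h|² dr dz`). Then
  `(∫ X₂ dx)² ≤ (32 C_GNS / c₂) (∫ X₁ dx)² ∫ X_D dx`
  (`c₂ = radialConst₂ = 2π`), i.e. `‖h‖²_{L²(Ω)} ≤ C ‖h‖_{L¹(Ω)} ‖∇h‖_{L²(Ω)}`. Proof: the meridian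
  profile `g = h ∘ meridianPoint`, `g(ρ, z) = h(ρ, 0, z)`, is `C¹` on `ℝ × ℝ` and even in `ρ`
  (`(−ρ, 0, z) = R_π (ρ, 0, z)`); by the cylindrical reduction `dx = r dr dθ dz`
  (`Wei2016.integral_weightedProfile`) `∫_{ℝ×ℝ} g² = (2/c₂) ∫ X₂`, `∫ |g| = (2/c₂) ∫ X₁`, and
  `∫ ‖Dg‖² ≤ 4 ∫ ‖Dh ∘ meridianPoint‖² = (8/c₂) ∫ X_D`; apply the planar inequality to `g`.

WHAT THIS IS NOT: nothing about Navier–Stokes — a functional inequality for axisymmetric scalars.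

## Mathlib / tree search

Tree (used): `sq_integral_sq_le_nash_of_integrable` (`PlanarNashInequalityWholeSpace`, Nash on
`EuclideanSpace ℝ (Fin 2)` without compact support), `Wei2016.integrable_weightedProfile` /
`Wei2016.integral_weightedProfile` (`Wei2016HalfPlane`: `c₂ ∫∫_{ρ>0} ρ G(ρ,0,z) = ∫ G dx`),
`IsAxisymmetricScalar.comp_meridianPoint_neg`, `IsAxisymmetricScalar.norm_fderiv`,
`norm_fderiv_comp_meridianPoint_le`, `ContDiff.comp_meridianPoint` (`AxisymShellLadyzhenskaya`,
`MeridianReduction`), `cylRadius_meridianPoint_eq_abs` (`CylindricalIntegration`).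
`lean search 'nash.*halfPlane|HalfPlaneNash|integral_sq_div_cylRadius'` (2026-08-27): nothing — the
tree's axisymmetric Ladyzhenskaya inequality `exists_axisym_ladyzhenskaya_const` is for shells
`{ϱ₀ ≤ ϱ ≤ ϱ₁}` off the axis. Mathlib: `Measure.measurePreserving_neg`, `MeasurePreserving.prod`,
`MeasurePreserving.integrableOn_comp_preimage`, `MeasurePreserving.setIntegral_preimage_emb`,
`MeasurableEquiv.finTwoArrow`, `volume_preserving_finTwoArrow`, `PiLp.volume_preserving_toLp`.

## References

* J. Nash, *Continuity of solutions of parabolic and elliptic equations*, Amer. J. Math. 80 (1958)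
  931–954, p. 936 (the inequality, `n = 2`). [Nash1958]
* Th. Gallay, V. Šverák, *Remarks on the Cauchy problem for the axisymmetric Navier–Stokes
  equations*, Confluentes Math. 7 (2015) 67–92 = arXiv:1510.01036, proof of Prop. 5.3, the Nash
  display after (5.8) (arXiv p. 16). [GallaySverak2016]
* D. Wei, *Regularity criterion to the axially symmetric Navier–Stokes equations*, J. Math. Anal.
  Appl. 435 (2016) 402–413 = arXiv:1508.03318, §2 (the convention `dx = r dr dz`). [Wei2016]
-/

noncomputable section

open MeasureTheory Set Function Filter Topology WithLp
open scoped RealInnerProductSpace ENNReal NNReal ContDiff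

namespace Literature.Analysis.FluidPDE

/-! ### Even functions on `ℝ × ℝ`: integrability and integral from the half-plane -/

section Even

/-- The reflection `(ρ, z) ↦ (−ρ, z)` of `ℝ × ℝ` as a measurable equivalence. [folklore] -/
private theorem coe_negFst_equiv :
    ⇑((MeasurableEquiv.neg ℝ).prodCongr (MeasurableEquiv.refl ℝ)) =
      fun q : ℝ × ℝ => (-q.1, q.2) := rfl

/-- The reflection `(ρ, z) ↦ (−ρ, z)` preserves Lebesgue measure on `ℝ × ℝ`. [folklore] -/
private theorem measurePreserving_negFst :
    MeasurePreserving (fun q : ℝ × ℝ => (-q.1, q.2)) volume volume := by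
  have h := (Measure.measurePreserving_neg (volume : Measure ℝ)).prod
    (MeasurePreserving.id (volume : Measure ℝ))
  rw [Measure.volume_eq_prod]
  exact h

/-- The line `{0} × ℝ` is Lebesgue-null in `ℝ × ℝ`. [folklore] -/
private theorem volume_singleton_prod_univ :
    volume (({0} : Set ℝ) ×ˢ (univ : Set ℝ)) = 0 := by
  rw [Measure.volume_eq_prod, Measure.prod_prod, Real.volume_singleton, zero_mul]

/-- **Even functions: from the half-plane to the plane.** If `F : ℝ × ℝ → ℝ` is even in the first
variable and integrable on `(0, ∞) × ℝ`, then `F` is integrable on `ℝ × ℝ` and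
`∫ F = 2 ∫_{(0,∞)×ℝ} F`. [folklore] -/
private theorem integrable_and_integral_eq_two_mul_of_even {F : ℝ × ℝ → ℝ}
    (heven : ∀ ρ z, F (-ρ, z) = F (ρ, z))
    (hint : IntegrableOn F (Ioi (0 : ℝ) ×ˢ (univ : Set ℝ))) :
    Integrable F ∧ ∫ q, F q = 2 * ∫ q in Ioi (0 : ℝ) ×ˢ (univ : Set ℝ), F q := by
  set σ : ℝ × ℝ → ℝ × ℝ := fun q => (-q.1, q.2) with hσ
  have hσmp : MeasurePreserving σ volume volume := measurePreserving_negFst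
  have hσemb : MeasurableEmbedding σ := by
    rw [hσ, ← coe_negFst_equiv]
    exact ((MeasurableEquiv.neg ℝ).prodCongr (MeasurableEquiv.refl ℝ)).measurableEmbedding
  have hFσ : F ∘ σ = F := by
    funext q
    obtain ⟨ρ, z⟩ := q
    simp only [comp_apply, hσ, heven ρ z]
  have hpre : σ ⁻¹' (Iio (0 : ℝ) ×ˢ (univ : Set ℝ)) = Ioi (0 : ℝ) ×ˢ (univ : Set ℝ) := by
    ext q
    simp [hσ]
  -- the left half-plane by reflection
  have hneg : IntegrableOn F (Iio (0 : ℝ) ×ˢ (univ : Set ℝ)) := by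
    have h := (hσmp.integrableOn_comp_preimage hσemb (f := F) (s := Iio (0 : ℝ) ×ˢ univ)).1
    rw [hFσ, hpre] at h
    exact h hint
  have hnull : IntegrableOn F (({0} : Set ℝ) ×ˢ (univ : Set ℝ)) := by
    rw [IntegrableOn, Measure.restrict_eq_zero.2 volume_singleton_prod_univ]
    exact integrable_zero_measure
  have hIic_eq : Iic (0 : ℝ) ×ˢ (univ : Set ℝ) =
      Iio (0 : ℝ) ×ˢ (univ : Set ℝ) ∪ ({0} : Set ℝ) ×ˢ (univ : Set ℝ) := by
    rw [← union_prod, Iio_union_right]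
  have hIic : IntegrableOn F (Iic (0 : ℝ) ×ˢ (univ : Set ℝ)) := by
    rw [hIic_eq]; exact hneg.union hnull
  have huniv : (univ : Set (ℝ × ℝ)) = Ioi (0 : ℝ) ×ˢ (univ : Set ℝ) ∪ Iic (0 : ℝ) ×ˢ univ := by
    rw [← union_prod, Ioi_union_Iic, univ_prod_univ]
  have hI : Integrable F := by
    rw [← integrableOn_univ, huniv]
    exact hint.union hIic
  refine ⟨hI, ?_⟩
  -- the integral
  have hdisj : Disjoint (Ioi (0 : ℝ) ×ˢ (univ : Set ℝ)) (Iic (0 : ℝ) ×ˢ univ) := by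
    rw [disjoint_left]
    rintro ⟨ρ, z⟩ h1 h2
    simp only [mem_prod, mem_Ioi, mem_univ, and_true, mem_Iic] at h1 h2
    linarith
  have hdisj' : Disjoint (Iio (0 : ℝ) ×ˢ (univ : Set ℝ)) (({0} : Set ℝ) ×ˢ univ) := by
    rw [disjoint_left]
    rintro ⟨ρ, z⟩ h1 h2
    simp only [mem_prod, mem_Iio, mem_univ, and_true, mem_singleton_iff] at h1 h2
    linarith
  have e1 : ∫ q, F q = (∫ q in Ioi (0 : ℝ) ×ˢ (univ : Set ℝ), F q) +
      ∫ q in Iic (0 : ℝ) ×ˢ (univ : Set ℝ), F q := by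
    rw [← setIntegral_univ, huniv]
    exact setIntegral_union hdisj (measurableSet_Iic.prod MeasurableSet.univ) hint hIic
  have e2 : ∫ q in Iic (0 : ℝ) ×ˢ (univ : Set ℝ), F q = ∫ q in Iio (0 : ℝ) ×ˢ (univ : Set ℝ), F q := by
    rw [hIic_eq, setIntegral_union hdisj' ((measurableSet_singleton 0).prod MeasurableSet.univ)
      hneg hnull, setIntegral_measure_zero F volume_singleton_prod_univ, add_zero]
  have e3 : ∫ q in Iio (0 : ℝ) ×ˢ (univ : Set ℝ), F q = ∫ q in Ioi (0 : ℝ) ×ˢ (univ : Set ℝ), F q := by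
    have h := hσmp.setIntegral_preimage_emb hσemb F (Iio (0 : ℝ) ×ˢ univ)
    rw [hpre] at h
    rw [← h]
    refine setIntegral_congr_fun (measurableSet_Ioi.prod MeasurableSet.univ) fun q _ => ?_
    exact congrFun hFσ q
  rw [e1, e2, e3]
  ring

end Even

/-! ### The planar Nash inequality on `ℝ × ℝ` -/

section Prod

/-- The coordinate map `EuclideanSpace ℝ (Fin 2) → ℝ × ℝ`, `p ↦ (p₀, p₁)`, as a measurable
equivalence (`toLp.symm` followed by `finTwoArrow`). [folklore] -/
private theorem coe_coordEquiv :
    ⇑((MeasurableEquiv.toLp 2 (Fin 2 → ℝ)).symm.trans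
        (MeasurableEquiv.finTwoArrow : (Fin 2 → ℝ) ≃ᵐ ℝ × ℝ)) =
      fun p : EuclideanSpace ℝ (Fin 2) => (p 0, p 1) := rfl

/-- `p ↦ (p₀, p₁)` preserves Lebesgue measure. [folklore] -/
private theorem measurePreserving_coord :
    MeasurePreserving (fun p : EuclideanSpace ℝ (Fin 2) => (p 0, p 1)) volume volume := by
  rw [← coe_coordEquiv]
  exact (EuclideanSpace.volume_preserving_symm_measurableEquiv_toLp (Fin 2)).trans
    (volume_preserving_finTwoArrow ℝ)

/-- `p ↦ (p₀, p₁)` as a continuous linear map, with operator norm `≤ 1`. [folklore] -/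
private theorem norm_coordCLM_le :
    ‖((EuclideanSpace.proj (0 : Fin 2) : EuclideanSpace ℝ (Fin 2) →L[ℝ] ℝ).prod
        (EuclideanSpace.proj (1 : Fin 2) : EuclideanSpace ℝ (Fin 2) →L[ℝ] ℝ))‖ ≤ 1 := by
  refine ContinuousLinearMap.opNorm_le_bound _ zero_le_one fun p => ?_
  rw [one_mul, Prod.norm_def]
  refine max_le ?_ ?_
  · exact PiLp.norm_apply_le p 0
  · exact PiLp.norm_apply_le p 1

/-- **The planar Nash inequality on `ℝ × ℝ`.** For `g ∈ C¹(ℝ × ℝ)` with `g ∈ L¹ ∩ L²` and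
`Dg ∈ L²` (operator norms for the sup norm of `ℝ × ℝ`):
`(∫ g²)² ≤ 4 C_GNS (∫ |g|)² ∫ ‖Dg‖²`, `C_GNS = lintegralPowLePowLIntegralFDerivConst volume 2` of
`EuclideanSpace ℝ (Fin 2)` — the tree's `sq_integral_sq_le_nash_of_integrable` transported along the
measure-preserving coordinate map `p ↦ (p₀, p₁)`, whose operator norm is `≤ 1`
(`‖D(g ∘ coord)(p)‖ ≤ ‖Dg(p₀, p₁)‖`). [cite: Nash1958, p. 936 (the inequality for n = 2)] -/
theorem sq_integral_sq_le_nash_prod {g : ℝ × ℝ → ℝ} (hg : ContDiff ℝ 1 g) (h1 : Integrable g)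
    (h2 : Integrable fun q => g q ^ 2) (hD : Integrable fun q => ‖fderiv ℝ g q‖ ^ 2) :
    (∫ q, g q ^ 2) ^ 2 ≤
      4 * (lintegralPowLePowLIntegralFDerivConst (volume : Measure (EuclideanSpace ℝ (Fin 2))) 2 : ℝ) *
        (∫ q, |g q|) ^ 2 * ∫ q, ‖fderiv ℝ g q‖ ^ 2 := by
  set L : EuclideanSpace ℝ (Fin 2) →L[ℝ] ℝ × ℝ :=
    (EuclideanSpace.proj (0 : Fin 2) : EuclideanSpace ℝ (Fin 2) →L[ℝ] ℝ).prod
      (EuclideanSpace.proj (1 : Fin 2) : EuclideanSpace ℝ (Fin 2) →L[ℝ] ℝ) with hL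
  have hLapply : ∀ p : EuclideanSpace ℝ (Fin 2), L p = (p 0, p 1) := fun p => rfl
  have hcoe : (fun p : EuclideanSpace ℝ (Fin 2) => (p 0, p 1)) = ⇑L := funext fun p => (hLapply p).symm
  have hmp : MeasurePreserving (⇑L) volume volume := by rw [← hcoe]; exact measurePreserving_coord
  have hemb : MeasurableEmbedding (⇑L) := by
    rw [← hcoe, ← coe_coordEquiv]
    exact ((MeasurableEquiv.toLp 2 (Fin 2 → ℝ)).symm.trans MeasurableEquiv.finTwoArrow).measurableEmbedding
  -- the transported function
  set f : EuclideanSpace ℝ (Fin 2) → ℝ := fun p => g (L p) with hf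
  have hf1 : ContDiff ℝ 1 f := hg.comp L.contDiff
  have hgd : Differentiable ℝ g := hg.differentiable one_ne_zero
  have hDf : ∀ p, ‖fderiv ℝ f p‖ ≤ ‖fderiv ℝ g (L p)‖ := by
    intro p
    have h : HasFDerivAt f ((fderiv ℝ g (L p)).comp L) p :=
      (hgd (L p)).hasFDerivAt.comp p L.hasFDerivAt
    rw [h.fderiv]
    refine (ContinuousLinearMap.opNorm_comp_le _ _).trans ?_
    have := norm_coordCLM_le
    rw [← hL] at this
    calc ‖fderiv ℝ g (L p)‖ * ‖L‖ ≤ ‖fderiv ℝ g (L p)‖ * 1 :=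
          mul_le_mul_of_nonneg_left this (norm_nonneg _)
      _ = ‖fderiv ℝ g (L p)‖ := mul_one _
  -- integrability and integrals through the measure-preserving map
  have hI1 : Integrable f := (hmp.integrable_comp_emb hemb (g := g)).2 h1
  have hI2 : Integrable fun p => f p ^ 2 :=
    (hmp.integrable_comp_emb hemb (g := fun q => g q ^ 2)).2 h2
  have hIDg : Integrable fun p => ‖fderiv ℝ g (L p)‖ ^ 2 :=
    (hmp.integrable_comp_emb hemb (g := fun q => ‖fderiv ℝ g q‖ ^ 2)).2 hD
  have hIDf : Integrable fun p => ‖fderiv ℝ f p‖ ^ 2 := by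
    refine hIDg.mono' ((hf1.continuous_fderiv one_ne_zero).norm.pow 2).aestronglyMeasurable
      (Eventually.of_forall fun p => ?_)
    rw [Real.norm_of_nonneg (sq_nonneg _)]
    exact pow_le_pow_left₀ (norm_nonneg _) (hDf p) 2
  have e2 : ∫ p, f p ^ 2 = ∫ q, g q ^ 2 := hmp.integral_comp hemb (fun q => g q ^ 2)
  have e1 : ∫ p, |f p| = ∫ q, |g q| := hmp.integral_comp hemb (fun q => |g q|)
  have eD : ∫ p, ‖fderiv ℝ f p‖ ^ 2 ≤ ∫ q, ‖fderiv ℝ g q‖ ^ 2 := by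
    rw [← hmp.integral_comp hemb (fun q => ‖fderiv ℝ g q‖ ^ 2)]
    exact integral_mono hIDf hIDg fun p => pow_le_pow_left₀ (norm_nonneg _) (hDf p) 2
  have hN := sq_integral_sq_le_nash_of_integrable hf1 hI1 hI2 hIDf
  rw [e2, e1] at hN
  refine hN.trans ?_
  have h0 : 0 ≤ 4 * (lintegralPowLePowLIntegralFDerivConst
      (volume : Measure (EuclideanSpace ℝ (Fin 2))) 2 : ℝ) * (∫ q, |g q|) ^ 2 := by positivity
  exact mul_le_mul_of_nonneg_left eD h0

end Prod

/-! ### Nash on the half-plane for axisymmetric scalars, in `ℝ³` vocabulary -/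

section HalfPlane

variable {h X₁ X₂ XD : EuclideanSpace ℝ (Fin 3) → ℝ}

/-- On the open half-plane the weighted profile of `X` is the profile of `r X`:
for `ρ > 0`, `ρ X(ρ, 0, z) = (r X)(ρ, 0, z)`. [folklore] -/
private theorem fst_mul_apply_meridianPoint {X Y : EuclideanSpace ℝ (Fin 3) → ℝ}
    (hXY : ∀ x, cylRadius x * X x = Y x) {q : ℝ × ℝ} (hq : q ∈ Ioi (0 : ℝ) ×ˢ (univ : Set ℝ)) :
    q.1 * X (meridianPoint (q.1, q.2)) = Y (meridianPoint q) := by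
  have hρ : 0 < q.1 := hq.1
  rw [← hXY (meridianPoint q), show (q.1, q.2) = q from rfl, show meridianPoint q =
    meridianPoint (q.1, q.2) from rfl, cylRadius_meridianPoint_eq_abs, abs_of_pos hρ]

/-- **Transfer of one weighted quantity.** For a continuous integrable axisymmetric scalar `X` and
an axisymmetric scalar `Y` with `r X = Y`: the meridian profile `Y ∘ meridianPoint` is integrable
on `ℝ × ℝ` and `∫_{ℝ×ℝ} Y(ρ, 0, z) d(ρ, z) = (2/c₂) ∫ X dx` (`dx = r dr dθ dz`, the profile of `Y`
being even in `ρ`; Wei 2016, §2: "`dx = r dr dz`"). [cite: Wei2016, §2 (the convention dx = r dr dz, arXiv:1508.03318)] -/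
theorem integrable_profile_and_integral_eq_of_cylRadius_mul_eq {X Y : EuclideanSpace ℝ (Fin 3) → ℝ}
    (hXa : IsAxisymmetricScalar X) (hXc : Continuous X) (hXi : Integrable X)
    (hYa : IsAxisymmetricScalar Y) (hXY : ∀ x, cylRadius x * X x = Y x) :
    Integrable (fun q : ℝ × ℝ => Y (meridianPoint q)) ∧
      ∫ q : ℝ × ℝ, Y (meridianPoint q) = 2 / radialConst₂ * ∫ x, X x := by
  have hc₂ := radialConst₂_pos
  have hhalf : IntegrableOn (fun q : ℝ × ℝ => Y (meridianPoint q)) (Ioi (0 : ℝ) ×ˢ univ) :=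
    (Wei2016.integrable_weightedProfile hXa hXc hXi).congr_fun
      (fun q hq => fst_mul_apply_meridianPoint hXY hq) (measurableSet_Ioi.prod MeasurableSet.univ)
  have heven : ∀ ρ z, Y (meridianPoint (-ρ, z)) = Y (meridianPoint (ρ, z)) :=
    fun ρ z => hYa.comp_meridianPoint_neg ρ z
  obtain ⟨hI, hint⟩ := integrable_and_integral_eq_two_mul_of_even
    (F := fun q : ℝ × ℝ => Y (meridianPoint q)) heven hhalf
  refine ⟨hI, ?_⟩
  have hW := Wei2016.integral_weightedProfile hXa hXc hXi
  have e : ∫ q in Ioi (0 : ℝ) ×ˢ (univ : Set ℝ), Y (meridianPoint q) =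
      ∫ q in Ioi (0 : ℝ) ×ˢ (univ : Set ℝ), q.1 * X (meridianPoint (q.1, q.2)) :=
    (setIntegral_congr_fun (measurableSet_Ioi.prod MeasurableSet.univ) fun q hq =>
      fst_mul_apply_meridianPoint hXY hq).symm
  rw [hint, e, ← hW]
  field_simp

/-- **Nash's inequality on the half-plane `Ω`, in `ℝ³` vocabulary** (Gallay–Šverák's display after
(5.8): "`∫_Ω ω_θ² dr dz ≤ C (∫_Ω |ω_θ| dr dz)(∫_Ω |∇ω_θ|² dr dz)^{1/2}`"). Let `h : ℝ³ → ℝ` be a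
`C¹` axisymmetric scalar and `X₁, X₂, X_D` continuous integrable axisymmetric scalars with
`r X₁ = |h|`, `r X₂ = h²`, `r X_D = ‖Dh‖²` pointwise (`r = cylRadius`; thus `h = 0` on the axis and
`∫ X₂ dx = 2π‖h‖²_{L²(Ω)}`, `∫ X₁ dx = 2π‖h‖_{L¹(Ω)}`, `∫ X_D dx = 2π‖∇h‖²_{L²(Ω)}`). Then
`(∫ X₂ dx)² ≤ (32 C_GNS / c₂) (∫ X₁ dx)² ∫ X_D dx`, `C_GNS` the planar
Gagliardo–Nirenberg–Sobolev constant `lintegralPowLePowLIntegralFDerivConst volume 2` of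
`EuclideanSpace ℝ (Fin 2)` and `c₂ = radialConst₂ = 2π`; that is
`‖h‖⁴_{L²(Ω)} ≤ (16 C_GNS/π²)·π… = C ‖h‖²_{L¹(Ω)} ‖∇h‖²_{L²(Ω)}`. Proof: planar Nash
(`sq_integral_sq_le_nash_prod`) for the even meridian profile `g(ρ, z) = h(ρ, 0, z)` on `ℝ × ℝ`,
with `∫ g² = (2/c₂)∫X₂`, `∫|g| = (2/c₂)∫X₁` (cylindrical reduction, `dx = r dr dθ dz`) and
`∫‖Dg‖² ≤ 4∫‖Dh(ρ,0,z)‖² = (8/c₂)∫X_D`. [cite: GallaySverak2016, proof of Prop. 5.3, Nash display after (5.8) (arXiv p. 16); Nash1958, p. 936] -/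
theorem sq_integral_le_nash_halfPlane (hh : ContDiff ℝ 1 h) (hax : IsAxisymmetricScalar h)
    (hX₁a : IsAxisymmetricScalar X₁) (hX₁c : Continuous X₁) (hX₁i : Integrable X₁)
    (hX₂a : IsAxisymmetricScalar X₂) (hX₂c : Continuous X₂) (hX₂i : Integrable X₂)
    (hXDa : IsAxisymmetricScalar XD) (hXDc : Continuous XD) (hXDi : Integrable XD)
    (h1 : ∀ x, cylRadius x * X₁ x = |h x|) (h2 : ∀ x, cylRadius x * X₂ x = h x ^ 2)
    (hD : ∀ x, cylRadius x * XD x = ‖fderiv ℝ h x‖ ^ 2) :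
    (∫ x, X₂ x) ^ 2 ≤
      32 * (lintegralPowLePowLIntegralFDerivConst (volume : Measure (EuclideanSpace ℝ (Fin 2))) 2 : ℝ) /
        radialConst₂ * (∫ x, X₁ x) ^ 2 * ∫ x, XD x := by
  set C : ℝ := (lintegralPowLePowLIntegralFDerivConst (volume : Measure (EuclideanSpace ℝ (Fin 2))) 2 : ℝ)
    with hC
  have hC0 : 0 ≤ C := by rw [hC]; positivity
  have hc₂ := radialConst₂_pos
  have hhd : Differentiable ℝ h := hh.differentiable one_ne_zero
  -- the meridian profile
  set g : ℝ × ℝ → ℝ := h ∘ meridianPoint with hg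
  have hg1 : ContDiff ℝ 1 g := ContDiff.comp_meridianPoint hh
  -- the three transferred quantities
  have habs : IsAxisymmetricScalar fun x => |h x| := fun θ x => by simp only [hax θ x]
  have hsq : IsAxisymmetricScalar fun x => h x ^ 2 := fun θ x => by simp only [hax θ x]
  have hnD : IsAxisymmetricScalar fun x => ‖fderiv ℝ h x‖ ^ 2 := fun θ x => by
    simp only [hax.norm_fderiv hhd θ x]
  obtain ⟨hI1, e1⟩ := integrable_profile_and_integral_eq_of_cylRadius_mul_eq hX₁a hX₁c hX₁i habs h1
  obtain ⟨hI2, e2⟩ := integrable_profile_and_integral_eq_of_cylRadius_mul_eq hX₂a hX₂c hX₂i hsq h2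
  obtain ⟨hID, eD⟩ := integrable_profile_and_integral_eq_of_cylRadius_mul_eq hXDa hXDc hXDi hnD hD
  -- in terms of `g`
  have hg_abs : (fun q : ℝ × ℝ => |h (meridianPoint q)|) = fun q => |g q| := rfl
  have hg_sq : (fun q : ℝ × ℝ => h (meridianPoint q) ^ 2) = fun q => g q ^ 2 := rfl
  have hIg1 : Integrable g := by
    have : Integrable fun q : ℝ × ℝ => |g q| := by rw [← hg_abs]; exact hI1
    exact (integrable_norm_iff hg1.continuous.aestronglyMeasurable).1
      (by simpa only [Real.norm_eq_abs] using this)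
  have hIg2 : Integrable fun q => g q ^ 2 := by rw [← hg_sq]; exact hI2
  have hDg_le : ∀ q, ‖fderiv ℝ g q‖ ^ 2 ≤ 4 * ‖fderiv ℝ h (meridianPoint q)‖ ^ 2 := by
    intro q
    have hle := norm_fderiv_comp_meridianPoint_le hhd q
    have h0 : 0 ≤ ‖fderiv ℝ (h ∘ meridianPoint) q‖ := norm_nonneg _
    calc ‖fderiv ℝ g q‖ ^ 2 = ‖fderiv ℝ (h ∘ meridianPoint) q‖ ^ 2 := rfl
      _ ≤ (2 * ‖fderiv ℝ h (meridianPoint q)‖) ^ 2 := pow_le_pow_left₀ h0 hle 2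
      _ = 4 * ‖fderiv ℝ h (meridianPoint q)‖ ^ 2 := by ring
  have hIDg : Integrable fun q => ‖fderiv ℝ g q‖ ^ 2 := by
    refine (hID.const_mul 4).mono' ((hg1.continuous_fderiv one_ne_zero).norm.pow 2).aestronglyMeasurable
      (Eventually.of_forall fun q => ?_)
    rw [Real.norm_of_nonneg (sq_nonneg _)]
    exact hDg_le q
  have eDg : ∫ q, ‖fderiv ℝ g q‖ ^ 2 ≤ 8 / radialConst₂ * ∫ x, XD x := by
    calc ∫ q, ‖fderiv ℝ g q‖ ^ 2 ≤ ∫ q : ℝ × ℝ, 4 * ‖fderiv ℝ h (meridianPoint q)‖ ^ 2 :=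
          integral_mono hIDg (hID.const_mul 4) hDg_le
      _ = 4 * (2 / radialConst₂ * ∫ x, XD x) := by rw [integral_const_mul, eD]
      _ = 8 / radialConst₂ * ∫ x, XD x := by ring
  -- planar Nash for `g`
  have hN := sq_integral_sq_le_nash_prod hg1 hIg1 hIg2 hIDg
  rw [← hg_sq, ← hg_abs, e2, e1, ← hC] at hN
  have hc₂' : radialConst₂ ≠ 0 := hc₂.ne'
  -- assemble: `((2/c₂)I₂)² ≤ 4C ((2/c₂)I₁)² ∫‖Dg‖² ≤ 4C ((2/c₂)I₁)² (8/c₂) I_D`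
  have hstep : (2 / radialConst₂ * ∫ x, X₂ x) ^ 2 ≤
      4 * C * (2 / radialConst₂ * ∫ x, X₁ x) ^ 2 * (8 / radialConst₂ * ∫ x, XD x) :=
    hN.trans (mul_le_mul_of_nonneg_left eDg
      (mul_nonneg (mul_nonneg (by norm_num) hC0) (sq_nonneg _)))
  have key : (∫ x, X₂ x) ^ 2 * (4 / radialConst₂ ^ 2) ≤
      (32 * C / radialConst₂ * (∫ x, X₁ x) ^ 2 * ∫ x, XD x) * (4 / radialConst₂ ^ 2) := by
    have e : (2 / radialConst₂ * ∫ x, X₂ x) ^ 2 = (∫ x, X₂ x) ^ 2 * (4 / radialConst₂ ^ 2) := by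
      field_simp
      ring
    have e' : 4 * C * (2 / radialConst₂ * ∫ x, X₁ x) ^ 2 * (8 / radialConst₂ * ∫ x, XD x) =
        (32 * C / radialConst₂ * (∫ x, X₁ x) ^ 2 * ∫ x, XD x) * (4 / radialConst₂ ^ 2) := by
      field_simp
      ring
    rw [← e, ← e']
    exact hstep
  exact le_of_mul_le_mul_right key (div_pos (by norm_num) (pow_pos hc₂ 2))

end HalfPlane

end Literature.Analysis.FluidPDE

end
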